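import Mathlib
import HarnessLib
import Summits.NavierStokesRegularity.NavierStokesRegularity.Theorems.PoloidalWindowDoorLrcModEntireTHCert

/-!
# Route `PoloidalWindowDoor`, crux `PoloidalWindowRigidity` (stmt-19708) / item `LrcModEntire` (stmt-20428) —
# a local (TH) datum is GLOBAL on every preconnected set of analyticity (identity principle): germ ⇒ slab

Seat ns-poloidal-K2-p2 g8 (interim LEAD-of-record on 19708; file `--supports`; brick 1 of rung R2 of line `sparse_energy` and a
free strengthening of the local (TH) statement for every line).  The local (TH)∩twisting datum `(u, μ(t,z), A(t,z))` of
`…TwistingTHLocalDatum.exists_localTHDatum` carries its four laws — poloidal `∂₀u₁ = ∂₁u₀`, `div u = 0`, shear `∂₂u_b = μ(t,x₂)∂_bu₂`,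
and the scalar law E — only on the small window `U ∋ p₀`.  But each law is the vanishing of a REAL-ANALYTIC function of `(t,x)`
on any open set `S ⊇ U` where `u` is jointly analytic and `μ`, `A` are analytic at the shadow points `(t, x₂)` (the letters of
`…THCertLetters` / `…THCertDictionary` are analytic there: `analyticAt_letterFn`); so by the identity principle
(`AnalyticOnNhd.eqOn_zero_of_preconnected_of_eventuallyEq_zero`) every law holds on ALL of `S` as soon as `S` is preconnected:

* `pol_on_of_germ`, `div_on_of_germ`, `shear_on_of_germ`, `eLaw_on_of_germ` — the four propagation statements (abstract `S`);
* `isPreconnected_hslab`, `isOpen_hslab` — the horizontal slab `(t₁,t₂) × {x : z₁ < x₂ < z₂}` is open and preconnected (convex), the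
  set of analyticity of a datum whose slope/pressure functions live on the box `(t₁,t₂) × (z₁,z₂)`.

Consequence (used by rung R2 «plane means ⇒ A ≡ 0» and available to the engines): for a class profile the (TH) system with datum
`(μ, A)` holds on WHOLE HORIZONTAL PLANES through the window, where the profile is bounded — the base point of the local statement may
be moved anywhere in the plane, and plane means of E make sense.

WHAT THIS IS NOT: not a proof of the stub and not a claim about Navier–Stokes regularity — analytic continuation bookkeeping
(bears_on LADDER-NS N0 via crux 19708 / item 20428).
-/

noncomputable section

-- the summit and its single sub-problem share the name (CONVENTIONS §1), as in every Theorems file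
set_option linter.dupNamespace false

namespace Summit.NavierStokesRegularity.NavierStokesRegularity.Theorems.PoloidalWindowDoorLrcModEntireTwistingTHSlab

open Set Function Filter Topology Metric
open scoped RealInnerProductSpace InnerProductSpace Laplacian
open Literature.Analysis Literature.Analysis.FluidPDE
open Summit.NavierStokesRegularity.NavierStokesRegularity.Theorems.PoloidalWindowDoorLrcModEntireJetLetters
open Summit.NavierStokesRegularity.NavierStokesRegularity.Theorems.PoloidalWindowDoorLrcModEntireTHCertLetters
open Summit.NavierStokesRegularity.NavierStokesRegularity.Theorems.PoloidalWindowDoorLrcModEntireTHCertDictionary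
open Summit.NavierStokesRegularity.NavierStokesRegularity.Theorems.PoloidalWindowDoorLrcModEntireTHCert

variable {u : ℝ → EuclideanSpace ℝ (Fin 3) → EuclideanSpace ℝ (Fin 3)} {μ A : ℝ → ℝ → ℝ}
  {S U : Set (ℝ × EuclideanSpace ℝ (Fin 3))}

/-! ### Letters are analytic on any set of analyticity of the datum -/

/-- The shadow map `(t, x) ↦ (t, x₂)` is analytic. [folklore] -/
theorem analyticAt_shadow (p : ℝ × EuclideanSpace ℝ (Fin 3)) :
    AnalyticAt ℝ (fun q : ℝ × EuclideanSpace ℝ (Fin 3) => ((q.1, q.2 2) : ℝ × ℝ)) p :=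
  analyticAt_fst.prod (((EuclideanSpace.proj (2 : Fin 3) : EuclideanSpace ℝ (Fin 3) →L[ℝ] ℝ).analyticAt _).comp
    analyticAt_snd)

/-- **Every letter is analytic on `S`** when `u` is jointly analytic on `S` and `μ`, `A` are analytic at the shadow points of `S`.
[folklore] -/
theorem analyticOnNhd_letterFn (hu : AnalyticOnNhd ℝ (uncurry u) S)
    (hμ : ∀ p ∈ S, AnalyticAt ℝ (uncurry μ) (p.1, p.2 2)) (hA : ∀ p ∈ S, AnalyticAt ℝ (uncurry A) (p.1, p.2 2))
    (ℓ : THLetter) : AnalyticOnNhd ℝ (letterFn u μ A ℓ) S := by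
  intro p hp
  cases ℓ with
  | W i a b c d => exact analyticOnNhd_jetLetter (analyticOnNhd_comp hu i) _ p hp
  | M a d =>
    exact AnalyticAt.comp (g := jetLetter (uncurry μ) (word2 a d))
      (f := fun q : ℝ × EuclideanSpace ℝ (Fin 3) => ((q.1, q.2 2) : ℝ × ℝ))
      (analyticOnNhd_jetLetter (analyticOnNhd_analyticSet μ) _ _ (hμ p hp)) (analyticAt_shadow p)
  | A a d =>
    exact AnalyticAt.comp (g := jetLetter (uncurry A) (word2 a d))
      (f := fun q : ℝ × EuclideanSpace ℝ (Fin 3) => ((q.1, q.2 2) : ℝ × ℝ))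
      (analyticOnNhd_jetLetter (analyticOnNhd_analyticSet A) _ _ (hA p hp)) (analyticAt_shadow p)

/-! ### The four laws as analytic defect functions -/

/-- The E-defect in letters: `(1−M₀₀)(Wₜ + Σₖ W₀ₖ·∂ₖW − ΔW) − A₀₀ − (M₁₀ − M₀₂)W − M₀₁W²/2 + 2M₀₁∂_zW` (`W = u₂`). [folklore] -/
theorem eDefect_eq (hS : IsOpen S) (hu : AnalyticOnNhd ℝ (uncurry u) S)
    (hμ : ∀ p ∈ S, AnalyticAt ℝ (uncurry μ) (p.1, p.2 2)) {p : ℝ × EuclideanSpace ℝ (Fin 3)} (hp : p ∈ S) :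
    (1 - letterFn u μ A (.M 0 0) p) *
        (letterFn u μ A (.W 2 1 0 0 0) p +
          (letterFn u μ A (.W 0 0 0 0 0) p * letterFn u μ A (.W 2 0 1 0 0) p +
            letterFn u μ A (.W 1 0 0 0 0) p * letterFn u μ A (.W 2 0 0 1 0) p +
            letterFn u μ A (.W 2 0 0 0 0) p * letterFn u μ A (.W 2 0 0 0 1) p) -
          (letterFn u μ A (.W 2 0 2 0 0) p + letterFn u μ A (.W 2 0 0 2 0) p + letterFn u μ A (.W 2 0 0 0 2) p)) -
      (letterFn u μ A (.A 0 0) p +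
        (letterFn u μ A (.M 1 0) p - letterFn u μ A (.M 0 2) p) * letterFn u μ A (.W 2 0 0 0 0) p +
        letterFn u μ A (.M 0 1) p / 2 * letterFn u μ A (.W 2 0 0 0 0) p ^ 2 -
        2 * letterFn u μ A (.M 0 1) p * letterFn u μ A (.W 2 0 0 0 1) p) =
    (1 - μ p.1 (p.2 2)) *
        (deriv (fun s => u s p.2 2) p.1 + fderiv ℝ (fun y => u p.1 y 2) p.2 (u p.1 p.2) - Δ (fun y => u p.1 y 2) p.2) -
      (A p.1 (p.2 2) + (deriv (fun s => μ s (p.2 2)) p.1 - deriv (deriv (μ p.1)) (p.2 2)) * u p.1 p.2 2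
        + deriv (μ p.1) (p.2 2) / 2 * u p.1 p.2 2 ^ 2 - 2 * deriv (μ p.1) (p.2 2) * fderiv ℝ (u p.1) p.2 (EuclideanSpace.single 2 1) 2) := by
  have hconv : fderiv ℝ (fun y => u p.1 y 2) p.2 (u p.1 p.2) =
      ∑ k : Fin 3, u p.1 p.2 k * fderiv ℝ (u p.1) p.2 (EuclideanSpace.single k 1) 2 := by
    rw [Summit.NavierStokesRegularity.NavierStokesRegularity.Theorems.PoloidalWindowDoorPoloidalWindowRigidityClebschVorticity.clf_apply_eq_sum3]
    refine Finset.sum_congr rfl fun k _ => ?_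
    rw [fderiv_slice_comp hu hp]
  have hlap := laplacian_slice_eq hu hp
  simp only [Fin.sum_univ_three, fderiv_fderiv_slice_comp hu hS hp] at hconv hlap
  rw [hconv, hlap, letterFn_M00, letterFn_Wt hu 2 hp, letterFn_W0, letterFn_W0, letterFn_W0, letterFn_Wx hu 2 hp,
    letterFn_Wy hu 2 hp, letterFn_Wz hu 2 hp, letterFn_W2xx hu hS hp, letterFn_W2yy hu hS hp, letterFn_W2zz hu hS hp,
    letterFn_A00, letterFn_M10 hμ hp, letterFn_M02 hμ hp, letterFn_M01 hμ hp]

/-! ### Germs propagate to every preconnected set of analyticity -/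

/-- **Poloidality propagates**: `∂₀u₁ = ∂₁u₀` on a nonempty open `U ⊆ S` ⇒ on all of `S` (`S` open, preconnected, `u` analytic).
[folklore] -/
theorem pol_on_of_germ (hSc : IsPreconnected S) (hu : AnalyticOnNhd ℝ (uncurry u) S)
    (hU : IsOpen U) (hne : U.Nonempty) (hUS : U ⊆ S)
    (hpol : ∀ p ∈ U, fderiv ℝ (u p.1) p.2 (EuclideanSpace.single 0 1) 1 = fderiv ℝ (u p.1) p.2 (EuclideanSpace.single 1 1) 0) :
    ∀ p ∈ S, fderiv ℝ (u p.1) p.2 (EuclideanSpace.single 0 1) 1 = fderiv ℝ (u p.1) p.2 (EuclideanSpace.single 1 1) 0 := by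
  have hμ0 : ∀ p ∈ S, AnalyticAt ℝ (uncurry fun _ _ : ℝ => (0 : ℝ)) (p.1, p.2 2) := fun p _ => analyticAt_const
  set G : ℝ × EuclideanSpace ℝ (Fin 3) → ℝ := fun p =>
    letterFn u (fun _ _ => 0) (fun _ _ => 0) (.W 1 0 1 0 0) p - letterFn u (fun _ _ => 0) (fun _ _ => 0) (.W 0 0 0 1 0) p with hG
  have hGa : AnalyticOnNhd ℝ G S :=
    (analyticOnNhd_letterFn hu hμ0 hμ0 _).sub (analyticOnNhd_letterFn hu hμ0 hμ0 _)
  have hGS : ∀ p ∈ S, G p = fderiv ℝ (u p.1) p.2 (EuclideanSpace.single 0 1) 1 - fderiv ℝ (u p.1) p.2 (EuclideanSpace.single 1 1) 0 :=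
    fun p hp => by rw [hG]; dsimp only; rw [letterFn_Wx hu 1 hp, letterFn_Wy hu 0 hp]
  obtain ⟨p₀, hp₀⟩ := hne
  have hev : G =ᶠ[𝓝 p₀] 0 := by
    filter_upwards [hU.mem_nhds hp₀] with q hq
    rw [Pi.zero_apply, hGS q (hUS hq), hpol q hq, sub_self]
  intro p hp
  have hz := hGa.eqOn_zero_of_preconnected_of_eventuallyEq_zero hSc (hUS hp₀) hev hp
  rw [hGS p hp] at hz
  exact sub_eq_zero.1 hz

/-- **Incompressibility propagates**: `div u = 0` on a nonempty open `U ⊆ S` ⇒ on all of `S`. [folklore] -/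
theorem div_on_of_germ (hSc : IsPreconnected S) (hu : AnalyticOnNhd ℝ (uncurry u) S)
    (hU : IsOpen U) (hne : U.Nonempty) (hUS : U ⊆ S)
    (hdiv : ∀ p ∈ U, fderiv ℝ (u p.1) p.2 (EuclideanSpace.single 0 1) 0 + fderiv ℝ (u p.1) p.2 (EuclideanSpace.single 1 1) 1 +
      fderiv ℝ (u p.1) p.2 (EuclideanSpace.single 2 1) 2 = 0) :
    ∀ p ∈ S, fderiv ℝ (u p.1) p.2 (EuclideanSpace.single 0 1) 0 + fderiv ℝ (u p.1) p.2 (EuclideanSpace.single 1 1) 1 +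
      fderiv ℝ (u p.1) p.2 (EuclideanSpace.single 2 1) 2 = 0 := by
  have hμ0 : ∀ p ∈ S, AnalyticAt ℝ (uncurry fun _ _ : ℝ => (0 : ℝ)) (p.1, p.2 2) := fun p _ => analyticAt_const
  set G : ℝ × EuclideanSpace ℝ (Fin 3) → ℝ := fun p =>
    letterFn u (fun _ _ => 0) (fun _ _ => 0) (.W 0 0 1 0 0) p + letterFn u (fun _ _ => 0) (fun _ _ => 0) (.W 1 0 0 1 0) p +
      letterFn u (fun _ _ => 0) (fun _ _ => 0) (.W 2 0 0 0 1) p with hG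
  have hGa : AnalyticOnNhd ℝ G S :=
    ((analyticOnNhd_letterFn hu hμ0 hμ0 _).add (analyticOnNhd_letterFn hu hμ0 hμ0 _)).add (analyticOnNhd_letterFn hu hμ0 hμ0 _)
  have hGS : ∀ p ∈ S, G p = fderiv ℝ (u p.1) p.2 (EuclideanSpace.single 0 1) 0 + fderiv ℝ (u p.1) p.2 (EuclideanSpace.single 1 1) 1 +
      fderiv ℝ (u p.1) p.2 (EuclideanSpace.single 2 1) 2 :=
    fun p hp => by rw [hG]; dsimp only; rw [letterFn_Wx hu 0 hp, letterFn_Wy hu 1 hp, letterFn_Wz hu 2 hp]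
  obtain ⟨p₀, hp₀⟩ := hne
  have hev : G =ᶠ[𝓝 p₀] 0 := by
    filter_upwards [hU.mem_nhds hp₀] with q hq
    rw [Pi.zero_apply, hGS q (hUS hq), hdiv q hq]
  intro p hp
  have hz := hGa.eqOn_zero_of_preconnected_of_eventuallyEq_zero hSc (hUS hp₀) hev hp
  rwa [hGS p hp] at hz

/-- **The slope law propagates**: `∂₂u_b = μ(t,x₂)∂_bu₂` (`b = 0,1`) on a nonempty open `U ⊆ S` ⇒ on all of `S`, for `μ` analytic at the
shadow points of `S`. [folklore] -/
theorem shear_on_of_germ (hSc : IsPreconnected S) (hu : AnalyticOnNhd ℝ (uncurry u) S)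
    (hμ : ∀ p ∈ S, AnalyticAt ℝ (uncurry μ) (p.1, p.2 2)) (hU : IsOpen U) (hne : U.Nonempty) (hUS : U ⊆ S)
    (hsh : ∀ p ∈ U, ∀ b : Fin 3, b ≠ 2 →
      fderiv ℝ (u p.1) p.2 (EuclideanSpace.single 2 1) b = μ p.1 (p.2 2) * fderiv ℝ (u p.1) p.2 (EuclideanSpace.single b 1) 2) :
    ∀ p ∈ S, ∀ b : Fin 3, b ≠ 2 →
      fderiv ℝ (u p.1) p.2 (EuclideanSpace.single 2 1) b = μ p.1 (p.2 2) * fderiv ℝ (u p.1) p.2 (EuclideanSpace.single b 1) 2 := by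
  obtain ⟨p₀, hp₀⟩ := hne
  -- the two defects, in letters
  set G0 : ℝ × EuclideanSpace ℝ (Fin 3) → ℝ := fun p =>
    letterFn u μ μ (.W 0 0 0 0 1) p - letterFn u μ μ (.M 0 0) p * letterFn u μ μ (.W 2 0 1 0 0) p with hG0
  set G1 : ℝ × EuclideanSpace ℝ (Fin 3) → ℝ := fun p =>
    letterFn u μ μ (.W 1 0 0 0 1) p - letterFn u μ μ (.M 0 0) p * letterFn u μ μ (.W 2 0 0 1 0) p with hG1
  have hG0a : AnalyticOnNhd ℝ G0 S := (analyticOnNhd_letterFn hu hμ hμ _).sub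
    ((analyticOnNhd_letterFn hu hμ hμ _).mul (analyticOnNhd_letterFn hu hμ hμ _))
  have hG1a : AnalyticOnNhd ℝ G1 S := (analyticOnNhd_letterFn hu hμ hμ _).sub
    ((analyticOnNhd_letterFn hu hμ hμ _).mul (analyticOnNhd_letterFn hu hμ hμ _))
  have hG0S : ∀ p ∈ S, G0 p = fderiv ℝ (u p.1) p.2 (EuclideanSpace.single 2 1) 0 -
      μ p.1 (p.2 2) * fderiv ℝ (u p.1) p.2 (EuclideanSpace.single 0 1) 2 :=
    fun p hp => by rw [hG0]; dsimp only; rw [letterFn_Wz hu 0 hp, letterFn_M00, letterFn_Wx hu 2 hp]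
  have hG1S : ∀ p ∈ S, G1 p = fderiv ℝ (u p.1) p.2 (EuclideanSpace.single 2 1) 1 -
      μ p.1 (p.2 2) * fderiv ℝ (u p.1) p.2 (EuclideanSpace.single 1 1) 2 :=
    fun p hp => by rw [hG1]; dsimp only; rw [letterFn_Wz hu 1 hp, letterFn_M00, letterFn_Wy hu 2 hp]
  have hev0 : G0 =ᶠ[𝓝 p₀] 0 := by
    filter_upwards [hU.mem_nhds hp₀] with q hq
    rw [Pi.zero_apply, hG0S q (hUS hq), hsh q hq 0 (by decide), sub_self]
  have hev1 : G1 =ᶠ[𝓝 p₀] 0 := by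
    filter_upwards [hU.mem_nhds hp₀] with q hq
    rw [Pi.zero_apply, hG1S q (hUS hq), hsh q hq 1 (by decide), sub_self]
  have h0 : ∀ p ∈ S, fderiv ℝ (u p.1) p.2 (EuclideanSpace.single 2 1) 0 =
      μ p.1 (p.2 2) * fderiv ℝ (u p.1) p.2 (EuclideanSpace.single 0 1) 2 := fun p hp => by
    have hz := hG0a.eqOn_zero_of_preconnected_of_eventuallyEq_zero hSc (hUS hp₀) hev0 hp
    rw [hG0S p hp] at hz; exact sub_eq_zero.1 hz
  have h1 : ∀ p ∈ S, fderiv ℝ (u p.1) p.2 (EuclideanSpace.single 2 1) 1 =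
      μ p.1 (p.2 2) * fderiv ℝ (u p.1) p.2 (EuclideanSpace.single 1 1) 2 := fun p hp => by
    have hz := hG1a.eqOn_zero_of_preconnected_of_eventuallyEq_zero hSc (hUS hp₀) hev1 hp
    rw [hG1S p hp] at hz; exact sub_eq_zero.1 hz
  intro p hp b hb
  fin_cases b
  · exact h0 p hp
  · exact h1 p hp
  · exact absurd rfl hb

/-- **The scalar law E propagates**: E on a nonempty open `U ⊆ S` ⇒ E on all of `S`, for `μ`, `A` analytic at the shadow points of
`S`. [folklore] -/
theorem eLaw_on_of_germ (hS : IsOpen S) (hSc : IsPreconnected S) (hu : AnalyticOnNhd ℝ (uncurry u) S)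
    (hμ : ∀ p ∈ S, AnalyticAt ℝ (uncurry μ) (p.1, p.2 2)) (hA : ∀ p ∈ S, AnalyticAt ℝ (uncurry A) (p.1, p.2 2))
    (hU : IsOpen U) (hne : U.Nonempty) (hUS : U ⊆ S)
    (hE : ∀ p ∈ U,
      (1 - μ p.1 (p.2 2)) *
          (deriv (fun s => u s p.2 2) p.1 + fderiv ℝ (fun y => u p.1 y 2) p.2 (u p.1 p.2) - Δ (fun y => u p.1 y 2) p.2) =
        A p.1 (p.2 2) + (deriv (fun s => μ s (p.2 2)) p.1 - deriv (deriv (μ p.1)) (p.2 2)) * u p.1 p.2 2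
          + deriv (μ p.1) (p.2 2) / 2 * u p.1 p.2 2 ^ 2 - 2 * deriv (μ p.1) (p.2 2) * fderiv ℝ (u p.1) p.2 (EuclideanSpace.single 2 1) 2) :
    ∀ p ∈ S,
      (1 - μ p.1 (p.2 2)) *
          (deriv (fun s => u s p.2 2) p.1 + fderiv ℝ (fun y => u p.1 y 2) p.2 (u p.1 p.2) - Δ (fun y => u p.1 y 2) p.2) =
        A p.1 (p.2 2) + (deriv (fun s => μ s (p.2 2)) p.1 - deriv (deriv (μ p.1)) (p.2 2)) * u p.1 p.2 2
          + deriv (μ p.1) (p.2 2) / 2 * u p.1 p.2 2 ^ 2 - 2 * deriv (μ p.1) (p.2 2) * fderiv ℝ (u p.1) p.2 (EuclideanSpace.single 2 1) 2 := by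
  obtain ⟨p₀, hp₀⟩ := hne
  set L : THLetter → (ℝ × EuclideanSpace ℝ (Fin 3) → ℝ) := letterFn u μ A with hL
  set G : ℝ × EuclideanSpace ℝ (Fin 3) → ℝ := fun p =>
    (1 - L (.M 0 0) p) *
        (L (.W 2 1 0 0 0) p +
          (L (.W 0 0 0 0 0) p * L (.W 2 0 1 0 0) p + L (.W 1 0 0 0 0) p * L (.W 2 0 0 1 0) p +
            L (.W 2 0 0 0 0) p * L (.W 2 0 0 0 1) p) -
          (L (.W 2 0 2 0 0) p + L (.W 2 0 0 2 0) p + L (.W 2 0 0 0 2) p)) -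
      (L (.A 0 0) p + (L (.M 1 0) p - L (.M 0 2) p) * L (.W 2 0 0 0 0) p +
        L (.M 0 1) p / 2 * L (.W 2 0 0 0 0) p ^ 2 - 2 * L (.M 0 1) p * L (.W 2 0 0 0 1) p) with hG
  have ha : ∀ ℓ, AnalyticOnNhd ℝ (L ℓ) S := fun ℓ => by rw [hL]; exact analyticOnNhd_letterFn hu hμ hA ℓ
  have hGa : AnalyticOnNhd ℝ G S := by
    rw [hG]
    exact ((analyticOnNhd_const.sub (ha _)).mul
      (((ha _).add ((((ha _).mul (ha _)).add ((ha _).mul (ha _))).add ((ha _).mul (ha _)))).sub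
        (((ha _).add (ha _)).add (ha _)))).sub
      ((((ha _).add (((ha _).sub (ha _)).mul (ha _))).add (((ha _).div analyticOnNhd_const fun _ _ => two_ne_zero).mul ((ha _).pow 2))).sub
        ((analyticOnNhd_const.mul (ha _)).mul (ha _)))
  have hGS : ∀ p ∈ S, G p =
      (1 - μ p.1 (p.2 2)) *
          (deriv (fun s => u s p.2 2) p.1 + fderiv ℝ (fun y => u p.1 y 2) p.2 (u p.1 p.2) - Δ (fun y => u p.1 y 2) p.2) -
        (A p.1 (p.2 2) + (deriv (fun s => μ s (p.2 2)) p.1 - deriv (deriv (μ p.1)) (p.2 2)) * u p.1 p.2 2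
          + deriv (μ p.1) (p.2 2) / 2 * u p.1 p.2 2 ^ 2 - 2 * deriv (μ p.1) (p.2 2) * fderiv ℝ (u p.1) p.2 (EuclideanSpace.single 2 1) 2) :=
    fun p hp => by rw [hG, hL]; exact eDefect_eq hS hu hμ hp
  have hev : G =ᶠ[𝓝 p₀] 0 := by
    filter_upwards [hU.mem_nhds hp₀] with q hq
    rw [Pi.zero_apply, hGS q (hUS hq), hE q hq, sub_self]
  intro p hp
  have hz := hGa.eqOn_zero_of_preconnected_of_eventuallyEq_zero hSc (hUS hp₀) hev hp
  rw [hGS p hp] at hz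
  exact sub_eq_zero.1 hz

/-! ### The horizontal slab of a box datum -/

/-- The horizontal slab `(t₁,t₂) × {x : z₁ < x₂ < z₂}` is open. [folklore] -/
theorem isOpen_hslab (t₁ t₂ z₁ z₂ : ℝ) :
    IsOpen (Ioo t₁ t₂ ×ˢ {x : EuclideanSpace ℝ (Fin 3) | z₁ < x 2 ∧ x 2 < z₂}) := by
  have hc : Continuous fun x : EuclideanSpace ℝ (Fin 3) => x 2 := (EuclideanSpace.proj (2 : Fin 3)).continuous
  exact isOpen_Ioo.prod ((isOpen_lt continuous_const hc).inter (isOpen_lt hc continuous_const))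

/-- The horizontal slab `(t₁,t₂) × {x : z₁ < x₂ < z₂}` is preconnected (it is convex). [folklore] -/
theorem isPreconnected_hslab (t₁ t₂ z₁ z₂ : ℝ) :
    IsPreconnected (Ioo t₁ t₂ ×ˢ {x : EuclideanSpace ℝ (Fin 3) | z₁ < x 2 ∧ x 2 < z₂}) := by
  refine ((convex_Ioo t₁ t₂).prod ?_).isPreconnected
  have h : {x : EuclideanSpace ℝ (Fin 3) | z₁ < x 2 ∧ x 2 < z₂} =
      (EuclideanSpace.proj (2 : Fin 3) : EuclideanSpace ℝ (Fin 3) →L[ℝ] ℝ) ⁻¹' Ioo z₁ z₂ := by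
    ext x; simp [mem_Ioo]
  rw [h]
  exact (convex_Ioo z₁ z₂).linear_preimage ((EuclideanSpace.proj (2 : Fin 3) : EuclideanSpace ℝ (Fin 3) →L[ℝ] ℝ).toLinearMap)

/-- On the horizontal slab of a box, a datum `μ` analytic on the box `(t₁,t₂) × (z₁,z₂)` is analytic at every shadow point. [folklore] -/
theorem analyticAt_shadow_of_box {t₁ t₂ z₁ z₂ : ℝ} (hμ : ∀ q ∈ Ioo t₁ t₂ ×ˢ Ioo z₁ z₂, AnalyticAt ℝ (uncurry μ) q) :
    ∀ p ∈ Ioo t₁ t₂ ×ˢ {x : EuclideanSpace ℝ (Fin 3) | z₁ < x 2 ∧ x 2 < z₂}, AnalyticAt ℝ (uncurry μ) (p.1, p.2 2) :=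
  fun p hp => hμ (p.1, p.2 2) (mk_mem_prod hp.1 hp.2)

end Summit.NavierStokesRegularity.NavierStokesRegularity.Theorems.PoloidalWindowDoorLrcModEntireTwistingTHSlab

end
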